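import Mathlib.Analysis.InnerProductSpace.l2Space
import Mathlib.Topology.Algebra.InfiniteSum.Basic
import Literature.Analysis.UnboundedOperators.DiagonalOperator
import Literature.NumberTheory.LFunctions.WeilExplicit
import HarnessLib

/-!
# Trace formulae for self-adjoint operators with discrete spectrum

Topic `Literature/Analysis/UnboundedOperators` (definition item `defn-SelfAdjointTraceFormula`,
for `stmt-RiemannHypothesis-0189`, route `RiemannHypothesis/SpectralTrace`, crux #2).

The spectral side of the Connes / Berry–Keating programme asks for a self-adjoint operator `D`
with compact resolvent whose *distributional trace* `g ↦ Tr ĝ(D)`, `ĝ(D) = ∫ g(t) e^{itD} dt`,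
equals a prescribed functional `W` — for the Riemann zeta function, Weil's functional
`Literature.NumberTheory.LFunctions.weilFunctional` of the explicit formula `∑_ρ ĝ(ρ) = W(g)` (Connes 1999, §III;
Meyer 2005; Berry–Keating 1999, §1). For `D` self-adjoint with eigenvalues `λ_k` (with
multiplicity, `|λ_k| → ∞`), `Tr ĝ(D) = ∑_k ∫ g(t) e^{iλ_k t} dt = ∑_k ĝ(1/2 + iλ_k)` in the
`1/2`-symmetric Mellin–Laplace normalisation `Literature.NumberTheory.LFunctions.weilMellin` of `WeilExplicit.lean`
(`weilMellin g s = ∫ g(t) e^{(s - 1/2)t} dt`).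

* `LinearPMap.SelfAdjointTraceFormula D W` — the v0 (eigenbasis) form requested by the planner,
  avoiding trace-class functional calculus (absent from Mathlib): `D` **is** the maximal diagonal
  operator `HilbertBasis.diagonalPMap b γ` with real symbol `γ : ι → ℝ` in some Hilbert basis `b`
  (hence self-adjoint: `HilbertBasis.isSelfAdjoint_diagonalPMap`, Reed–Simon I, §VIII.3 Prop. 1),
  the spectrum is discrete with finite multiplicities (`{i | |γ i| ≤ K}` finite for every `K`,
  i.e. compact resolvent), and for every Weil test function `g` (`Literature.NumberTheory.LFunctions.IsWeilTest`: smooth,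
  compactly supported) the eigenvalue sum `∑_i ĝ(1/2 + i γ_i)` converges (`HasSum`, i.e.
  unconditionally) to `W g`.
* API: the constructor `HilbertBasis.selfAdjointTraceFormula_diagonalPMap`, invariance under
  changing `W` off/on Weil tests (`SelfAdjointTraceFormula.congr`), and the finite-dimensional
  sanity case `HilbertBasis.selfAdjointTraceFormula_of_finite` (every diagonal operator with real
  symbol on a finite Hilbert basis satisfies the trace formula with `W g = ∑_i ĝ(1/2 + iγ_i)`;
  real proof, non-vacuity).

## Design choices

* Pattern and typing follow `LinearPMap.IsHilbertPolyaOperator` (`HilbertPolya.lean`): a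
  deliberate dot-notation extension of Mathlib's `LinearPMap`, index type `ι : Type u` in the
  universe of `H`, symbol coerced `ℝ → ℂ`. Self-adjointness is a *consequence* (via the named
  fact `HilbertBasis.isSelfAdjoint_diagonalPMap`), not a conjunct.
* "`D` has an orthonormal eigenbasis with real eigenvalues accumulating only at `∞`" is, for a
  self-adjoint operator, *equivalent* to "compact resolvent" (Reed–Simon IV, Thm XIII.64); taking
  the eigenbasis form as the definition is a theorem-as-definition, exactly as for
  `IsHilbertPolyaOperator`.
* The test-function class and transform are those of `WeilExplicit.lean`, so that
  `D.SelfAdjointTraceFormula Literature.weilFunctional` is literally "the trace formula for `D` is Weil's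
  explicit formula" (the intended instantiation).
* Mathlib has `HilbertBasis`, `LinearPMap`, `HasSum`; no trace class / `Tr f(D)` for unbounded
  `D` (searched `traceClass`, `IsTraceClass`): hence the eigenvalue-sum form.

## References

* A. Connes, *Trace formula in noncommutative geometry and the zeros of the Riemann zeta
  function*, Selecta Math. 5 (1999) 29–106, §III.
* R. Meyer, *On a representation of the idele class group related to primes and zeros of
  L-functions*, Duke Math. J. 127 (2005) 519–595.
* M. V. Berry, J. P. Keating, *The Riemann zeros and eigenvalue asymptotics*, SIAM Review 41
  (1999) 236–266, §1.
* M. Reed, B. Simon, *Methods of Modern Mathematical Physics I* (1980), §VIII.3; IV, Thm XIII.64.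
-/

noncomputable section

open Complex Literature.NumberTheory.LFunctions

universe u

namespace LinearPMap

variable {H : Type u} [NormedAddCommGroup H] [InnerProductSpace ℂ H]

/-- (Dot-notation extension of Mathlib's `LinearPMap`.) **Trace formula for a self-adjoint
operator with discrete spectrum.** `D.SelfAdjointTraceFormula W` says: `D` is the maximal
diagonal operator with real symbol `γ : ι → ℝ` in some Hilbert basis `b` of `H` (so `D` is
self-adjoint with orthonormal eigenbasis `b i ↦ γ i • b i`), its spectrum is discrete with finite
multiplicities and `|γ_i| → ∞` (`{i | |γ i| ≤ K}` is finite for every `K` — compact resolvent),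
and for every Weil test function `g` the distributional trace
`Tr ĝ(D) = ∑_i ∫ g(t) e^{iγ_i t} dt = ∑_i weilMellin g (1/2 + iγ_i)` converges unconditionally
with sum `W g`. With `W = Literature.weilFunctional` this is the spectral realisation of Weil's explicit
formula sought by the Hilbert–Pólya / Connes / Berry–Keating programme. [cite: Connes1999, §III] -/
def SelfAdjointTraceFormula (D : H →ₗ.[ℂ] H) (W : (ℝ → ℂ) → ℂ) : Prop :=
  ∃ (ι : Type u) (b : HilbertBasis ι ℂ H) (γ : ι → ℝ),
    D = b.diagonalPMap (fun i => (γ i : ℂ)) ∧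
    (∀ K : ℝ, {i | |γ i| ≤ K}.Finite) ∧
    ∀ g : ℝ → ℂ, IsWeilTest g → HasSum (fun i => weilMellin g (1 / 2 + γ i * I)) (W g)

/-- The trace formula only sees `W` on Weil test functions: if `W` and `W'` agree there, the
predicates agree. [cite: Connes1999, §III] -/
theorem SelfAdjointTraceFormula.congr {D : H →ₗ.[ℂ] H} {W W' : (ℝ → ℂ) → ℂ}
    (h : D.SelfAdjointTraceFormula W) (hW : ∀ g, IsWeilTest g → W g = W' g) :
    D.SelfAdjointTraceFormula W' := by
  obtain ⟨ι, b, γ, hD, hfin, hsum⟩ := h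
  exact ⟨ι, b, γ, hD, hfin, fun g hg => hW g hg ▸ hsum g hg⟩

/-- A trace formula pins down `W` on Weil test functions *for a fixed diagonalisation*: the
value `W g` is the (unique) sum of the eigenvalue series. Recorded in the form: the predicate
with `W` implies the predicate with the canonical `W' g := ∑' i, ĝ(1/2 + iγ_i)` of any witnessing
diagonalisation — here simply that `HasSum` determines its value. [cite: Connes1999, §III] -/
theorem SelfAdjointTraceFormula.eq_tsum {D : H →ₗ.[ℂ] H} {W : (ℝ → ℂ) → ℂ}
    (h : D.SelfAdjointTraceFormula W) :
    ∃ (ι : Type u) (b : HilbertBasis ι ℂ H) (γ : ι → ℝ),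
      D = b.diagonalPMap (fun i => (γ i : ℂ)) ∧
      ∀ g, IsWeilTest g → W g = ∑' i, weilMellin g (1 / 2 + γ i * I) := by
  obtain ⟨ι, b, γ, hD, -, hsum⟩ := h
  exact ⟨ι, b, γ, hD, fun g hg => (hsum g hg).tsum_eq.symm⟩

end LinearPMap

namespace HilbertBasis

variable {ι : Type u} {H : Type u} [NormedAddCommGroup H] [InnerProductSpace ℂ H]
  (b : HilbertBasis ι ℂ H)

/-- (Dot-notation extension of Mathlib's `HilbertBasis`.) Constructor: a diagonal operator with
real, discrete symbol whose eigenvalue sums converge to `W g` satisfies the trace formula.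
[cite: Connes1999, §III] -/
theorem selfAdjointTraceFormula_diagonalPMap (γ : ι → ℝ) {W : (ℝ → ℂ) → ℂ}
    (hfin : ∀ K : ℝ, {i | |γ i| ≤ K}.Finite)
    (hsum : ∀ g, IsWeilTest g → HasSum (fun i => weilMellin g (1 / 2 + γ i * I)) (W g)) :
    (b.diagonalPMap fun i => (γ i : ℂ)).SelfAdjointTraceFormula W :=
  ⟨ι, b, γ, rfl, hfin, hsum⟩

/-- (Dot-notation extension of Mathlib's `HilbertBasis`.) **Finite-dimensional sanity case /
non-vacuity.** On a finite Hilbert basis every diagonal operator with real symbol `γ` satisfies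
the trace formula with the finite eigenvalue sum `W g = ∑ i, ĝ(1/2 + iγ_i)` (`hasSum_fintype`).
[folklore] -/
theorem selfAdjointTraceFormula_of_finite [Fintype ι] (γ : ι → ℝ) :
    (b.diagonalPMap fun i => (γ i : ℂ)).SelfAdjointTraceFormula
      fun g => ∑ i, weilMellin g (1 / 2 + γ i * I) :=
  b.selfAdjointTraceFormula_diagonalPMap γ (fun _ => Set.toFinite _)
    fun _ _ => hasSum_fintype _

end HilbertBasis

end
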